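import Mathlib.Geometry.Manifold.Instances.Sphere
import Mathlib.Geometry.Manifold.Diffeomorph
import Mathlib.Topology.Homotopy.Contractible
import Literature.Topology.FourManifolds.Gluing
import Literature.Topology.FourManifolds.Handles
import Literature.Topology.FourManifolds.ClosedBall
import Literature.Topology.FourManifolds.ClosedBallProofs
import Literature.Topology.FourManifolds.DoubleThickening
import HarnessLib
import HarnessLib.Audit.Tags

/-!
# Gabai (2022), §13 — Poincaré 4-balls: embedding, double and thickening conjectures

Host summit `SmoothPoincare4` (soloist seat `solo-SmoothPoincare4-informed`).  Typed OBLIGATIONS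
(`@[conjecture] def … : Prop`, the gate's home for unproven conjectures is `Summits/…/Theorems`,
not `Literature`) reproducing PUBLISHED open statements, each cited to where it is STATED; nothing
here is claimed:

* D. Gabai, *3-Spheres in the 4-Sphere and Pseudo-Isotopies of `S¹ × S³`*, arXiv:2212.02004
  (v1 2022, v2 2024), §13 "Embedding Poincaré Balls in `S⁴`", pp. 62–64 (PDF pp. 66–68).

What is reproduced, as `Prop`-valued definitions over the tree's vocabulary for compact smooth
manifolds with boundary (`BoundaryData`, `IsDouble` of `Gluing.lean`; `IsHandlebodyOfIndexLE` of
`Handles.lean`; the closed ball `𝔻ⁿ⁺¹` as an `𝓡∂ (n + 1)`-manifold, `ClosedBall.lean`):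

* the definition of a **Poincaré 4-ball** (p. 62: *"By Poincaré 4-ball we mean a contractible
  4-manifold whose boundary is `S³`. A Schoenflies 4-ball is a Poincaré 4-ball that embeds in
  `S⁴`."*; Def. 1.3, p. 3, adds "compact oriented") — rendered inline, see "Conventions";
* the **Poincaré ball embedding conjecture** (p. 62: *"every Poincaré 4-ball embeds in `S⁴`"*,
  with *"It is well known that the smooth 4-dimensional Poincaré conjecture (SPC4) follows from the
  Schoenflies conjecture and the Poincaré ball embedding conjecture"*) —
  `PoincareBallEmbeddingConjecture`;
* **Conjecture 13.1** (*"If `Δ⁴` is a Poincaré ball, then `Δ⁴ × I` is diffeomorphic to `B⁵` and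
  hence is a Schoenflies ball"*) in the equivalent DOUBLE FORM of Remarks 13.2 (i) (*"Since a
  contractible 5-manifold with boundary `S⁴` is the 5-ball, p. 395 [Sm2], `Δ⁴ × I = B⁵` is
  equivalent to the double `D(Δ⁴)` of `Δ⁴` being diffeomorphic to `S⁴`. Note that
  `∂(Δ⁴ × I) = Δ⁴ ∪_∂ Δ̄⁴`"*) — `PoincareBallDoubleConjecture` (the tree has no products of
  manifolds with boundary, cf. the "Not here" section of `DoubleThickening.lean`, so the literal
  `Δ⁴ × I` form is not typed; the double form is the printed equivalent);
* **Conjecture 13.4 (ii)** (*"If `Δ⁵` is contractible and built from 0, 1 and 2-handles, then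
  `Δ⁵ = B⁵`"*) — `ContractibleTwoHandlebodyFiveIsBall`;
* **Remarks 13.5**, the *"stronger form of i)"*: *"`Δ⁴` itself has a handle decomposition with
  only 0, 1 and 2-handles"* — `PoincareBallIsTwoHandlebody`;
* **Conjecture 13.4 (i)** (*"If `Δ⁴` is a Poincaré ball, then `Δ⁴ × I` has a handle decomposition
  with only 0, 1 and 2-handles"*) in the THICKENING FORM the tree can type (again because `Δ⁴ × I`
  itself is not available): "the double `D(Δ⁴) = ∂(Δ⁴ × I)` bounds a compact contractible
  5-dimensional 2-handlebody" — `PoincareBallDoubleBoundsTwoHandlebody`.  This is implied by the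
  printed (i) (take `Δ⁴ × I`) and is exactly what the deduction "13.4 ⇒ 13.1" consumes.

Proved here (elementary logic over the tree's named facts, no new mathematics):

* `doubleBoundsTwoHandlebody_of_isTwoHandlebody` — Remarks 13.5 (strong form) together with the
  thickening fact `exists_thickening_of_isDouble` (`DoubleThickening.lean`: `∂(W × I) = D W`, a
  `k`-handlebody if `W` is one) gives the thickening form of 13.4 (i);
* `poincareBallEmbeddingConjecture_of_doubleConjecture` — the double conjecture implies the
  embedding conjecture (one half of a double `D(Δ) ≅ S⁴` is an embedded copy of `Δ`), given the
  existence of doubles (`exists_isBoundaryGluing`, `Gluing.lean`, a named fact of the tree).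

STATUS of every `def` below: OPEN (Gabai 2022, §13, states 13.1, 13.3, 13.4 as conjectures and
calls 13.4 (i), (ii) *"two notorious conjectures. See 4.89 [Ki2]"*; Remarks 13.5 (ii): *"The
Andrews–Curtis conjecture implies Conjecture 13.4 ii), however, the Akbulut–Kirby presentations
[AK] are potential Andrews–Curtis counterexamples … On the other hand, Gompf [Go] has shown that
`Δ⁵`'s arising from these presentations are 5-balls"*).  Each is implied by the smooth
4-dimensional Poincaré conjecture together with classical facts, and none is known to imply it;
hence no `_holds` theorems — use them only as hypotheses `(h : …)`.

## Not here

* Conjecture 13.3 (*"If `Δ⁴` is a Gluck ball, then `Δ⁴ × I = B⁵`"*) and Problem 13.6 (the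
  Miller–Schupp presentations give `B⁵`): they need Gluck twists of manifolds with boundary, resp.
  the 5-dimensional 2-handlebody of a balanced presentation, as objects; not typed in this file.
* Theorems 13.10 and 13.13 (stably trivial relative h-cobordisms; carving/2-handle
  presentations): statements about Morse data on relative h-cobordisms, not typed in this file.
* Orientations: Def. 1.3 asks `Δ` to be oriented; a contractible manifold is orientable and every
  statement below is insensitive to the choice, so the orientation is dropped (as in the tree's
  unbundled homotopy 4-spheres, `HomotopyBallSlice.lean`, design notes).

Dimension bookkeeping follows the tree's convention of writing `n + 1` for manifolds with boundary
(`EuclideanHalfSpace (3 + 1)` for 4-manifolds with boundary, `EuclideanHalfSpace (3 + 1 + 1)` for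
their 5-dimensional thickenings, `𝕊⁴ ⊂ 𝔼 (3 + 1 + 1)` charted on `𝔼 (3 + 1)`), so that the
tree's lemmas stated for `n + 1` apply syntactically.

## References

* D. Gabai, *3-Spheres in the 4-Sphere and Pseudo-Isotopies of `S¹ × S³`*, arXiv:2212.02004v2
  (2024), §13, pp. 62–64. [cite: Gabai2022, §13: Def. p. 62, Conj. 13.1, Remarks 13.2,
  Conj. 13.4, Remarks 13.5]
* S. Smale, *On the structure of manifolds*, Amer. J. Math. 84 (1962) 387–399, p. 395
  (contractible 5-manifolds with boundary `S⁴`), as cited by Gabai, Remarks 13.2 (i).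
* R. Kirby (ed.), *Problems in low-dimensional topology* (1997), Problem 4.89.
-/

noncomputable section


open scoped Manifold ContDiff Topology
open Set Function

namespace Summit.SmoothPoincare4.SmoothPoincare4.Theorems

open Literature.Topology.FourManifolds

universe u


/-! ### Conventions

A **Poincaré 4-ball** (Gabai 2022, p. 62: *"a contractible 4-manifold whose boundary is `S³`"*;
Def. 1.3: *"a compact oriented contractible 4-manifold `Δ` with `∂Δ = S³`"*) is rendered INLINE in
every statement below as: a type `W : Type` with `[TopologicalSpace W] [T2Space W]
[SecondCountableTopology W] [ChartedSpace (EuclideanHalfSpace 4) W] [IsManifold (𝓡∂ 4) ∞ W]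
[CompactSpace W] [ContractibleSpace W]`, a boundary datum `b : BoundaryData (𝓡∂ 4) W (𝓡 3)` (the
tree's packaging of `∂W` with its smooth structure, `Cobordism.lean`) and the hypothesis
`Nonempty (b.carrier ≃ₘ⟮𝓡 3, 𝓡 3⟯ S³)` with `S³` the unit sphere of
`EuclideanSpace ℝ (Fin 4)` ("`∂W = S³`").  The orientation of Def. 1.3 is dropped (see the module
docstring). -/


/-- OPEN CONJECTURE — the **Poincaré ball embedding conjecture** (Gabai 2022, §13, p. 62: *"every
Poincaré 4-ball embeds in `S⁴`"*, i.e. every Poincaré ball is a *Schoenflies ball*; *"It is well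
known that the smooth 4-dimensional Poincaré conjecture (SPC4) follows from the Schoenflies
conjecture and the Poincaré ball embedding conjecture"*).  For every Hausdorff second-countable
smooth Poincaré 4-ball `(W, b)` there is a smooth embedding `W ↪ S⁴` of manifolds (with boundary
into the round `S⁴`).  Not dischargeable: use as a hypothesis.
[cite: Gabai2022, §13 p. 62] -/
@[conjecture] def PoincareBallEmbeddingConjecture : Prop :=
  ∀ (W : Type) [TopologicalSpace W] [T2Space W] [SecondCountableTopology W]
    [ChartedSpace (EuclideanHalfSpace (3 + 1)) W] [IsManifold (𝓡∂ (3 + 1)) ∞ W]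
    [CompactSpace W] [ContractibleSpace W] (b : BoundaryData (𝓡∂ (3 + 1)) W (𝓡 3)),
    Nonempty (b.carrier ≃ₘ⟮𝓡 3, 𝓡 3⟯ (Metric.sphere (0 : EuclideanSpace ℝ (Fin (3 + 1))) 1)) →
    ∃ φ : W → (Metric.sphere (0 : EuclideanSpace ℝ (Fin (3 + 1 + 1))) 1),
      Manifold.IsSmoothEmbedding (𝓡∂ (3 + 1)) (𝓡 (3 + 1)) ∞ φ

/-- OPEN CONJECTURE — **Gabai 2022, Conjecture 13.1, in the double form of Remarks 13.2 (i)**.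
Printed: *"Conjecture 13.1. If `Δ⁴` is a Poincaré ball, then `Δ⁴ × I` is diffeomorphic to `B⁵` and
hence is a Schoenflies ball."* and *"Remarks 13.2. i) Since a contractible 5-manifold with boundary
`S⁴` is the 5-ball, p. 395 [Sm2], `Δ⁴ × I = B⁵` is equivalent to the double `D(Δ⁴)` of `Δ⁴` being
diffeomorphic to `S⁴`. Note that `∂(Δ⁴ × I) = Δ⁴ ∪_∂ Δ̄⁴`."*  Typed: for every Hausdorff
second-countable smooth Poincaré 4-ball `(W, b)` and every Hausdorff second-countable smooth
4-manifold `P` which is a double of `W` along `b` (`IsDouble b (𝓡 4) P`, i.e. `P = W ∪_{id ∂W} W`),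
`P` is diffeomorphic to the round `S⁴`.  (Remarks 13.2 (ii): Gabai's Conjecture 1.12 is this
statement restricted to Schoenflies balls.)  Not dischargeable: use as a hypothesis.
[cite: Gabai2022, Conj. 13.1 and Remarks 13.2 (i)] -/
@[conjecture] def PoincareBallDoubleConjecture : Prop :=
  ∀ (W : Type) [TopologicalSpace W] [T2Space W] [SecondCountableTopology W]
    [ChartedSpace (EuclideanHalfSpace (3 + 1)) W] [IsManifold (𝓡∂ (3 + 1)) ∞ W]
    [CompactSpace W] [ContractibleSpace W] (b : BoundaryData (𝓡∂ (3 + 1)) W (𝓡 3)),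
    Nonempty (b.carrier ≃ₘ⟮𝓡 3, 𝓡 3⟯ (Metric.sphere (0 : EuclideanSpace ℝ (Fin (3 + 1))) 1)) →
    ∀ (P : Type) [TopologicalSpace P] [T2Space P] [SecondCountableTopology P]
      [ChartedSpace (EuclideanSpace ℝ (Fin (3 + 1))) P] [IsManifold (𝓡 (3 + 1)) ∞ P],
      IsDouble b (𝓡 (3 + 1)) P →
        Nonempty
          (P ≃ₘ⟮𝓡 (3 + 1), 𝓡 (3 + 1)⟯ (Metric.sphere (0 : EuclideanSpace ℝ (Fin (3 + 1 + 1))) 1))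

/-- OPEN CONJECTURE — **Gabai 2022, Conjecture 13.4 (ii)**: *"If `Δ⁵` is contractible and built
from 0, 1 and 2-handles, then `Δ⁵ = B⁵`."*  Typed: every compact contractible Hausdorff
second-countable smooth 5-manifold with boundary which is a handlebody with handles of index `≤ 2`
(`IsHandlebodyOfIndexLE (3 + 1) 2 V`: a Morse function adapted to `∂V` with all critical points of
index `≤ 2`) is diffeomorphic to the closed 5-ball `𝔻⁵`.  Remarks 13.5 (ii): implied by the
Andrews–Curtis conjecture; known for the 5-manifolds of the Akbulut–Kirby presentations (Gompf).
Not dischargeable: use as a hypothesis. [cite: Gabai2022, Conj. 13.4 (ii), Remarks 13.5 (ii)] -/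
@[conjecture] def ContractibleTwoHandlebodyFiveIsBall : Prop :=
  ∀ (V : Type) [TopologicalSpace V] [T2Space V] [SecondCountableTopology V]
    [ChartedSpace (EuclideanHalfSpace (3 + 1 + 1)) V] [IsManifold (𝓡∂ (3 + 1 + 1)) ∞ V]
    [CompactSpace V] [ContractibleSpace V],
    IsHandlebodyOfIndexLE (3 + 1) 2 V →
      Nonempty (V ≃ₘ⟮𝓡∂ (3 + 1 + 1), 𝓡∂ (3 + 1 + 1)⟯
        (Metric.closedBall (0 : EuclideanSpace ℝ (Fin (3 + 1 + 1))) 1))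

/-- OPEN CONJECTURE — **Gabai 2022, Remarks 13.5, the "stronger form of (i)"**: *"A stronger form
of i) is that `Δ⁴` itself has a handle decomposition with only 0, 1 and 2-handles."*  Typed: every
Hausdorff second-countable smooth Poincaré 4-ball is a handlebody with handles of index `≤ 2`
(`IsHandlebodyOfIndexLE 3 2 W`; equivalently, no 3- and 4-handles).  This is the relative form of
Kirby's Problem 4.89 restricted to Poincaré balls.  Not dischargeable: use as a hypothesis.
[cite: Gabai2022, Remarks 13.5] -/
@[conjecture] def PoincareBallIsTwoHandlebody : Prop :=
  ∀ (W : Type) [TopologicalSpace W] [T2Space W] [SecondCountableTopology W]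
    [ChartedSpace (EuclideanHalfSpace (3 + 1)) W] [IsManifold (𝓡∂ (3 + 1)) ∞ W]
    [CompactSpace W] [ContractibleSpace W] (b : BoundaryData (𝓡∂ (3 + 1)) W (𝓡 3)),
    Nonempty (b.carrier ≃ₘ⟮𝓡 3, 𝓡 3⟯ (Metric.sphere (0 : EuclideanSpace ℝ (Fin (3 + 1))) 1)) →
      IsHandlebodyOfIndexLE 3 2 W

/-- OPEN CONJECTURE — **Gabai 2022, Conjecture 13.4 (i), thickening form**.  Printed: *"If `Δ⁴` is
a Poincaré ball, then `Δ⁴ × I` has a handle decomposition with only 0, 1 and 2-handles."*  The tree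
has no product `Δ⁴ × I` of a manifold with boundary (corners; see `DoubleThickening.lean`, "Not
here"), so we type the consequence that the deduction "13.4 (i) ∧ (ii) ⇒ 13.1" uses, with
`∂(Δ⁴ × I) = D(Δ⁴)` (Remarks 13.2 (i)) built in: for every Hausdorff second-countable smooth
Poincaré 4-ball `(W, b)` and every double `P` of `W`, there is a compact contractible Hausdorff
second-countable smooth 5-manifold with boundary `V` which is a handlebody of index `≤ 2` and whose
boundary is `P` (a smooth embedding `φ : P → V` onto `∂V`).  The printed (i) gives this with
`V = Δ⁴ × I`; the strong form `PoincareBallIsTwoHandlebody` gives it via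
`exists_thickening_of_isDouble` (`doubleBoundsTwoHandlebody_of_isTwoHandlebody`).  Not
dischargeable: use as a hypothesis. [cite: Gabai2022, Conj. 13.4 (i) with Remarks 13.2 (i)] -/
@[conjecture] def PoincareBallDoubleBoundsTwoHandlebody : Prop :=
  ∀ (W : Type) [TopologicalSpace W] [T2Space W] [SecondCountableTopology W]
    [ChartedSpace (EuclideanHalfSpace (3 + 1)) W] [IsManifold (𝓡∂ (3 + 1)) ∞ W]
    [CompactSpace W] [ContractibleSpace W] (b : BoundaryData (𝓡∂ (3 + 1)) W (𝓡 3)),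
    Nonempty (b.carrier ≃ₘ⟮𝓡 3, 𝓡 3⟯ (Metric.sphere (0 : EuclideanSpace ℝ (Fin (3 + 1))) 1)) →
    ∀ (P : Type) [TopologicalSpace P] [T2Space P] [SecondCountableTopology P]
      [ChartedSpace (EuclideanSpace ℝ (Fin (3 + 1))) P] [IsManifold (𝓡 (3 + 1)) ∞ P],
      IsDouble b (𝓡 (3 + 1)) P →
      ∃ (V : Type) (_ : TopologicalSpace V) (_ : T2Space V) (_ : SecondCountableTopology V)
        (_ : ChartedSpace (EuclideanHalfSpace (3 + 1 + 1)) V)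
        (_ : IsManifold (𝓡∂ (3 + 1 + 1)) ∞ V) (_ : CompactSpace V),
        ContractibleSpace V ∧ IsHandlebodyOfIndexLE (3 + 1) 2 V ∧
        ∃ φ : P → V, Manifold.IsSmoothEmbedding (𝓡 (3 + 1)) (𝓡∂ (3 + 1 + 1)) ∞ φ ∧
          Set.range φ = (𝓡∂ (3 + 1 + 1)).boundary V

/-! ### Elementary implications -/

/-- Remarks 13.5 (strong form of 13.4 (i)) implies the thickening form of Conjecture 13.4 (i):
if the Poincaré ball `W` itself is a 2-handlebody then, by the thickening fact
`exists_thickening_of_isDouble` (`∂(W × I) = D W`, with handles of the same indices, `W × I ≃ W`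
contractible), every double of `W` bounds a compact contractible 5-dimensional 2-handlebody.
Gabai (2022), Remarks 13.5 with Remarks 13.2 (i); FGMW (2010), proof of Fact 2.
[cite: Gabai2022, Remarks 13.5] -/
theorem doubleBoundsTwoHandlebody_of_isTwoHandlebody (h₁ : PoincareBallIsTwoHandlebody)
    (hT : exists_thickening_of_isDouble) : PoincareBallDoubleBoundsTwoHandlebody := by
  intro W _ _ _ _ _ _ _ b hb P _ _ _ _ _ hP
  exact exists_thickening_of_isDouble.of_contractibleSpace hT 3 2 W (h₁ W b hb) b P hP

/-- **The double conjecture implies the embedding conjecture** (Gabai 2022, Conjecture 13.1: "… and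
hence is a Schoenflies ball"): if `D(W) ≅ S⁴` then the first copy of `W` in its double is a smoothly
embedded copy of `W` in `S⁴`.  The existence of the double `W ∪_{id} W` is the tree's named gluing
fact `exists_isBoundaryGluing` (Hirsch 1976, Thm. 8.2.1), taken as the hypothesis `hG`.
[cite: Gabai2022, Conj. 13.1 and §13 p. 62] -/
theorem poincareBallEmbeddingConjecture_of_doubleConjecture
    (hG : ∀ (W : Type) [TopologicalSpace W] [T2Space W] [SecondCountableTopology W]
      [ChartedSpace (EuclideanHalfSpace (3 + 1)) W] [IsManifold (𝓡∂ (3 + 1)) ∞ W]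
      [CompactSpace W] (b : BoundaryData (𝓡∂ (3 + 1)) W (𝓡 3)), exists_isBoundaryGluing b b)
    (hD : PoincareBallDoubleConjecture) : PoincareBallEmbeddingConjecture := by
  intro W _ _ _ _ _ _ _ b hb
  obtain ⟨P, _, _, _, _, _, _, hP⟩ := hG W b (Diffeomorph.refl (𝓡 3) b.carrier ∞)
  have hdouble : IsDouble b (𝓡 (3 + 1)) P := by
    refine IsClosedGluing.congr hP (fun x y => ?_)
    simp
  obtain ⟨ψ⟩ := hD W b hb P hdouble
  obtain ⟨jA, jB, hA, -, -, -⟩ := hdouble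
  exact ⟨ψ ∘ jA, hA.diffeomorph_comp ψ⟩

end Summit.SmoothPoincare4.SmoothPoincare4.Theorems
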